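import Summits.ResolutionOfSingularities.ResolutionOfSingularities.Theorems.MarkedTransferCampaignW46MohWindowShadeRunFormula
import HarnessLib

/-!
# [OURS · L1 W4.6] Rung (iii) "Moh window", surfaces — the DIGITS of a stall phase: the formal `p`-fold branch is
  canonical, its expansion is read off the points of the walk

Cell `res-hironaka`, rung L, slot W4.6, seat `res-L1-s46-pv-6` (gen 3).  Companion of `…MohWindowShadeRunFormula.lean`
(p505398), which states the run formula with an EXISTENTIAL digit polynomial `ψ`.  Here the same three theorems are
given with `ψ` EXPLICIT: after `k` consecutive point blow-ups of `x^p + F(y_j, y_i)` read in the chart `y_j` at the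
points `t_0, …, t_{k−1}` of the `y_i`-axis (`t_n = b n i`), the digit polynomial is
`ψ_k(y_j) = Σ_{n<k} t_n · y_j^{n+1}` — the truncations of ONE formal power series `ψ = Σ_n t_n y_j^{n+1}` whose
coefficients are the points of the walk:

* `run_formula_digits` — `F_k · y_j^{pk} + D = F₀(y_j, y_j^k·y_i + ψ_k(y_j))`, `D` `p`-th-power-supported;
* `digits_support_bound` — if `F_k` has all monomials of degree `≥ o`, every monomial `y^e` of
  `clean(F₀(y_j, y_i + ψ_k(y_j)))` has `o + pk ≤ e_j + (k+1)·e_i`;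
* `formal_pth_power_of_run_digits` — hence `F₀ ≡ (y_i − ψ_k(y_j))^p · w_k` modulo degree `≥ o + k`, for EVERY `k`
  with the SAME digits: along an infinite stall phase of shade `p` (the only infinite phases, `…StallWalk`) the
  residual polynomial is, to every order, the `p`-th power of the canonical formal smooth branch `y_i = ψ(y_j)` times
  a cofactor — the branch the walk follows digit by digit (each `t_n` is forced: it is the unique `p`-th root picked by
  the stall, gen 2's Hasse test).
OURS; replaces — for regime (iii) of RESCUE-SEED W4.6, the classical pair, surfaces — the ROLE of the termination clause
of Th. 16.13 (ms. p. 87 l. 25–29) by an explicit accounting of the walk; NOT a statement of the manuscript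
[claim: Hironaka2017, status: under-review], nothing of which is used.  AI review is weaker than expert review.
-/

noncomputable section

set_option linter.dupNamespace false -- mandated namespace of this single-conjunct summit

open MvPolynomial Finset

namespace Summit.ResolutionOfSingularities.ResolutionOfSingularities.Theorems.CampaignW46.MohWindowShadeDigits

open Literature.AlgebraicGeometry.Resolution
open Literature.AlgebraicGeometry.Resolution.PointBlowup
open Literature.AlgebraicGeometry.Resolution.Hauser2010
open Literature.Barriers.ResolutionOfSingularities (ordZero_le_of_coeff_ne_zero le_ordZero_of_forall)
open MohWindowShadeCleaning
open MohWindowShadeRunFormula (aeval_run_eq aeval_monomialSubst_eq_sum eq_of_add_single_eq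
  exists_cofactor_of_support_bound)

variable {σ : Type*} {K : Type*} [Field K] [Fintype σ] [DecidableEq σ] [DecidableEq K]
variable (p : ℕ) [hp : Fact p.Prime] [CharP K p]

section TwoLetters

variable {j i : σ}

omit [Fintype σ] [DecidableEq σ] [DecidableEq K] hp [CharP K p] in
/-- The digit polynomial `Σ_{n<k} t_n y_j^{n+1}` is fixed by every substitution fixing `y_j`. [folklore] -/
theorem aeval_digits (f : σ → MvPolynomial σ K) (hf : f j = X j) (t : ℕ → K) (k : ℕ) :
    aeval f (∑ n ∈ Finset.range k, C (t n) * X j ^ (n + 1)) = ∑ n ∈ Finset.range k, C (t n) * X j ^ (n + 1) := by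
  rw [map_sum]
  refine Finset.sum_congr rfl fun n _ => ?_
  rw [map_mul, map_pow, aeval_X, hf, aeval_C, MvPolynomial.algebraMap_eq]

omit [Fintype σ] [DecidableEq K] hp [CharP K p] in
/-- The digit polynomial has no constant term. [folklore] -/
theorem coeff_zero_digits (t : ℕ → K) (k : ℕ) :
    coeff 0 (∑ n ∈ Finset.range k, C (t n) * X j ^ (n + 1) : MvPolynomial σ K) = 0 := by
  rw [coeff_sum]
  refine Finset.sum_eq_zero fun n _ => ?_
  rw [coeff_C_mul, coeff_X_pow, if_neg, mul_zero]
  intro h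
  have := DFunLike.congr_fun h j
  rw [Finsupp.single_eq_same, Finsupp.coe_zero, Pi.zero_apply] at this
  exact absurd this (Nat.succ_ne_zero n)

omit [Fintype σ] [DecidableEq K] hp [CharP K p] in
/-- The digit polynomial has no `y_i`-term. [folklore] -/
theorem coeff_single_digits (hij : i ≠ j) (t : ℕ → K) (k : ℕ) :
    coeff (Finsupp.single i 1) (∑ n ∈ Finset.range k, C (t n) * X j ^ (n + 1) : MvPolynomial σ K) = 0 := by
  rw [coeff_sum]
  refine Finset.sum_eq_zero fun n _ => ?_
  rw [coeff_C_mul, coeff_X_pow, if_neg, mul_zero]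
  intro h
  have := DFunLike.congr_fun h i
  rw [Finsupp.single_eq_same, Finsupp.single_eq_of_ne hij] at this
  exact absurd this.symm Nat.one_ne_zero

/-- **[OURS · L1 W4.6] THE RUN FORMULA WITH EXPLICIT DIGITS.**  For consecutive steps `s_{n+1} = step p j (b n) (s n)` in
the chart `y_j` (`b n j = 0`), all residual polynomials having their monomials of degree `≥ p`:
`F_k · y_j^{pk} + D = F₀(y_j, y_j^k·y_i + ψ_k(y_j))` with `ψ_k = Σ_{n<k} (b n i)·y_j^{n+1}` and `D`
`p`-th-power-supported.  NOT a statement of the manuscript. [folklore] -/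
theorem run_formula_digits (hij : i ≠ j) (htwo : ∀ l, l = j ∨ l = i) (s : ℕ → State σ K) (b : ℕ → σ → K)
    (hb : ∀ n, b n j = 0) (hstep : ∀ n, s (n + 1) = step p j (b n) (s n))
    (hdeg : ∀ n, ∀ d ∈ (s n).F.support, p ≤ d.degree) (k : ℕ) :
    ∃ D : MvPolynomial σ K, (∀ d ∈ D.support, IsPthPowerExponent p d) ∧
      (s k).F * X j ^ (p * k) + D =
        aeval (fun l => if l = j then X j else
          X j ^ k * X l + ∑ n ∈ Finset.range k, C (b n i) * X j ^ (n + 1)) (s 0).F := by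
  induction k with
  | zero =>
    refine ⟨0, fun d hd => by simp at hd, ?_⟩
    have hid : (fun l => if l = j then X j else
        X j ^ 0 * X l + ∑ n ∈ Finset.range 0, C (b n i) * X j ^ (n + 1) : σ → MvPolynomial σ K) = X := by
      funext l
      split_ifs with h
      · rw [h]
      · rw [pow_zero, one_mul, Finset.sum_range_zero, add_zero]
    rw [hid, aeval_X_left_apply, mul_zero, pow_zero, mul_one, add_zero]
  | succ k ih =>
    obtain ⟨D, hD, hrun⟩ := ih
    obtain ⟨D₁, hD₁, hone⟩ := exists_step_mul_X_pow_add p hij htwo (b k) (hb k) (s k) (hdeg k)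
    set fb : σ → MvPolynomial σ K := fun l => if l = j then X j else (X l + C (b k l)) * X j with hfb
    have hfbj : fb j = X j := by rw [hfb]; exact if_pos rfl
    have hfbi : fb i = (X i + C (b k i)) * X j := by rw [hfb]; exact if_neg hij
    refine ⟨aeval fb D + D₁ * X j ^ (p * k), forall_support_add p (forall_support_aeval p fb hD)
        (forall_support_mul p hD₁ (forall_support_pow_mul p (X j) k)), ?_⟩
    have hcomp : (fun l => aeval fb ((fun l => if l = j then X j else
          X j ^ k * X l + ∑ n ∈ Finset.range k, C (b n i) * X j ^ (n + 1)) l))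
        = fun l => if l = j then X j else
          X j ^ (k + 1) * X l + ∑ n ∈ Finset.range (k + 1), C (b n i) * X j ^ (n + 1) := by
      funext l
      by_cases hl : l = j
      · simp only [hl, if_true]
        rw [aeval_X, hfbj]
      · have hli : l = i := by rcases htwo l with h | h; exacts [absurd h hl, h]
        simp only [hl, if_false]
        rw [map_add, map_mul, map_pow, aeval_X, aeval_X, hfbj, aeval_digits (j := j) fb hfbj, hli, hfbi,
          Finset.sum_range_succ]
        ring
    rw [hstep k, ← hcomp, ← comp_aeval_apply, ← hrun, map_add, map_mul, map_pow, aeval_X, hfbj,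
      ← hone, mul_add p k 1, mul_one, pow_add]
    ring

/-- **[OURS · L1 W4.6] THE SUPPORT OF THE DIGIT EXPANSION (explicit digits).**  Under the hypotheses of
`run_formula_digits`, from a CLEANED start, if every monomial of `F_k` has degree `≥ o`, then every monomial `y^e` of
`clean(F₀(y_j, y_i + ψ_k(y_j)))`, `ψ_k = Σ_{n<k} (b n i)·y_j^{n+1}`, satisfies `o + pk ≤ e_j + (k+1)·e_i`.  NOT a
statement of the manuscript. [folklore] -/
theorem digits_support_bound (hij : i ≠ j) (htwo : ∀ l, l = j ∨ l = i) (s : ℕ → State σ K) (b : ℕ → σ → K)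
    (hb : ∀ n, b n j = 0) (hstep : ∀ n, s (n + 1) = step p j (b n) (s n))
    (hclean : deletePthPowers p (s 0).F = (s 0).F) (hdeg : ∀ n, ∀ d ∈ (s n).F.support, p ≤ d.degree)
    (k : ℕ) {o : ℕ} (ho : ∀ d ∈ (s k).F.support, o ≤ d.degree) :
    ∀ e ∈ (deletePthPowers p (aeval (fun l => if l = j then X j else
        X l + ∑ n ∈ Finset.range k, C (b n i) * X j ^ (n + 1)) (s 0).F)).support,
      o + p * k ≤ e j + (k + 1) * e i := by
  classical
  obtain ⟨D, hD, hrun⟩ := run_formula_digits p hij htwo s b hb hstep hdeg k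
  set ψ : MvPolynomial σ K := ∑ n ∈ Finset.range k, C (b n i) * X j ^ (n + 1) with hψ
  have hψf : ∀ f : σ → MvPolynomial σ K, f j = X j → aeval f ψ = ψ := fun f hf => aeval_digits f hf _ k
  have hcleank : deletePthPowers p (s k).F = (s k).F := by
    rcases k with _ | k
    · exact hclean
    · rw [hstep k]; exact deletePthPowers_step p j (b k) (s k)
  set τ : σ → MvPolynomial σ K := fun l => if l = j then X j else X l + ψ with hτ
  set Hk : σ → MvPolynomial σ K := fun l => if l = j then X j else X j ^ k * X l with hHk
  set Q := deletePthPowers p (aeval τ (s 0).F) with hQ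
  have hQclean : ∀ d ∈ (aeval Hk Q).support, ¬ IsPthPowerExponent p d := by
    intro d hd hPd
    rw [hHk, aeval_monomialSubst_eq_sum hij htwo k Q] at hd
    obtain ⟨e, he, -, rfl⟩ := exists_of_mem_support_sum_monomial _ _ _ hd
    have hQe : ¬ IsPthPowerExponent p e :=
      not_isPthPowerExponent_of_clean p (deletePthPowers_deletePthPowers p _) he
    apply hQe
    rw [isPthPowerExponent_iff] at hPd ⊢
    have hi' := hPd i
    have hj' := hPd j
    simp only [Finsupp.add_apply, Finsupp.single_apply, if_true, if_neg hij.symm, add_zero] at hi' hj'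
    intro l
    rcases htwo l with rfl | rfl
    · exact (Nat.dvd_add_left (Dvd.dvd.mul_left hi' k)).mp hj'
    · exact hi'
  have hFk : (s k).F * X j ^ (p * k) = aeval Hk Q := by
    have h1 : aeval τ (s 0).F = Q + (aeval τ (s 0).F - Q) := by ring
    have hC₁ := forall_support_sub_deletePthPowers p (aeval τ (s 0).F)
    rw [aeval_run_eq hψf k, ← hHk, ← hτ, h1, map_add] at hrun
    have h2 := congrArg (deletePthPowers p) hrun
    rw [deletePthPowers_add_of_forall p _ hD, deletePthPowers_mul_X_pow, hcleank,
      deletePthPowers_add_of_forall p _ (forall_support_aeval p Hk hC₁),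
      deletePthPowers_eq_self_of_forall p hQclean] at h2
    exact h2
  intro e he
  have hcoeff : coeff (e + Finsupp.single j (k * e i)) (aeval Hk Q) = coeff e Q := by
    rw [hHk, aeval_monomialSubst_eq_sum hij htwo k Q]
    exact coeff_sum_monomial_of_injOn Q.support _ _ he
      (fun e' _ _ h => eq_of_add_single_eq hij htwo k h)
  have hmem : coeff (e + Finsupp.single j (k * e i)) ((s k).F * X j ^ (p * k)) ≠ 0 := by
    rw [hFk, hcoeff]; exact MvPolynomial.mem_support_iff.mp he
  rw [X_pow_eq_monomial, coeff_mul_monomial'] at hmem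
  split_ifs at hmem with hle
  · rw [mul_one] at hmem
    have hd := ho _ (MvPolynomial.mem_support_iff.mpr hmem)
    have h3 : (e + Finsupp.single j (k * e i) - Finsupp.single j (p * k)).degree
        + (Finsupp.single j (p * k)).degree = (e + Finsupp.single j (k * e i)).degree := by
      rw [← map_add, tsub_add_cancel_of_le hle]
    rw [map_add, Finsupp.degree_single, Finsupp.degree_single, degree_eq_add hij htwo e] at h3
    have h4 : (k + 1) * e i = k * e i + e i := by ring
    omega
  · exact absurd rfl hmem

/-- **[OURS · L1 W4.6] A STALL PHASE IS THE DIGIT EXPANSION OF A CANONICAL FORMAL `p`-FOLD BRANCH.**  Let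
`s_{n+1} = step p j (b n) (s n)` be consecutive point blow-ups of `x^p + F(y_j, y_i)` read in the chart `y_j` at the
points `t_n = b n i`, from a cleaned state, all residual polynomials with monomials of degree `≥ p`.  If the `k`-th
residual polynomial has all its monomials of degree `≥ o`, then
`F₀ ≡ (y_i − ψ_k(y_j))^p · w` modulo monomials of degree `≥ o + k`, with the EXPLICIT digit polynomial
`ψ_k = Σ_{n<k} t_n y_j^{n+1}`.  Along an infinite stall phase of shade `p` (order constant `= o`) this holds for every
`k` with the truncations `ψ_k` of the single formal power series `ψ = Σ_n t_n y_j^{n+1}`: the walk follows, digit by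
digit, the formal smooth branch `y_i = ψ(y_j)` along which `F₀` is formally a `p`-th power multiple.  NOT a statement
of the manuscript. [folklore] -/
theorem formal_pth_power_of_run_digits (hij : i ≠ j) (htwo : ∀ l, l = j ∨ l = i) (s : ℕ → State σ K)
    (b : ℕ → σ → K) (hb : ∀ n, b n j = 0) (hstep : ∀ n, s (n + 1) = step p j (b n) (s n))
    (hclean : deletePthPowers p (s 0).F = (s 0).F) (hdeg : ∀ n, ∀ d ∈ (s n).F.support, p ≤ d.degree)
    (k : ℕ) {o : ℕ} (ho : ∀ d ∈ (s k).F.support, o ≤ d.degree) :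
    ∃ w : MvPolynomial σ K, ((o + k : ℕ) : ℕ∞) ≤
      ordZero ((s 0).F - (X i - ∑ n ∈ Finset.range k, C (b n i) * X j ^ (n + 1)) ^ p * w) :=
  exists_cofactor_of_support_bound p hij htwo hclean (fun f hf => aeval_digits f hf _ k)
    (coeff_zero_digits _ k) (digits_support_bound p hij htwo s b hb hstep hclean hdeg k ho)

end TwoLetters

end Summit.ResolutionOfSingularities.ResolutionOfSingularities.Theorems.CampaignW46.MohWindowShadeDigits
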